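import Summits.AnomalousDissipation.AnomalousDissipation.Theorems.SawtoothPulseCascadeK1LocalisedCascadeCanonicalRatioSteps

/-!
# K1loc, line `Spectral` / thin start — helper: THE RATIO-CLASS STEPS ON CANONICAL BLOCKS, GENERIC LOWER CUT-OFF `Q₁` (closed-form junk)

Helper file of the prover lane on the crux `K1LocalisedCascade` (stmt-AnomalousDissipation-19491), route `SawtoothPulseCascade`
(S-B/S-C assembly seat; the LEDGER ASSEMBLY, concrete layer).  Each class step of the fibre ledger (`…RatioBlocks`: O-V, A-V, C-H,
B-H; `…StripBlocks`: S-V, T-H) on the CANONICAL geometry of `…CanonicalBlocks` (blocks `Λ_m = Λ₀2^m`, `m < M_b`; cut-offs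
`Q₂^m = ⌊q_nΛ_m/q_d⌋`, ANY lower cut-offs `Q₁^m` below `Q₂^m` carrying the feed inclusion and a cut-off ratio bound `r_m ≤ r*` — e.g. the additive family `⌊2u′Λ_m/v′⌋ + E` of `…CanonicalBlocks` §1 or the max family of `…CanonicalBlocksMax`; envelope scale `d₀^m = 8τ_m/A_m + Mδ_j/(πN_j)` and zone depth
`M = max 1 √(2 log(1/η))` of `…LedgerArith`; rounding allowance `ε₀^m = A_m·2π(Λ_{m+1}G)e^{−M²/2}/(2N_j)`), with the junk summed
in closed form by `…BlockJunk`: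
  `class ≤ (√J + √feed)² + ((1+γ)^{2j′}/(Λ₀2^{M_b}))²`,
  `J = 3r*²·((4/3)(A*πGηΛ₀2^{M_b}/N_j)² + 128·N_j·A*·τ₀ + 8·M_b·A*²·Mδ_j/π)`,
where `(A*, τ₀)` are the explicit block constants of `…CanonicalBlocks` and `r*` is the supplied cut-off ratio bound.  Hypotheses per
step: the class/feed slopes, `Λ₀`, `M_b`, `η`, the `Q₁`-facts, and THREE scalar inequalities (margin below the shift, fibre floor vs.
class threshold, `Mδ_j < π/2`).  This file: the ratio classes, `ratioClass_vstep_canonical_le` (O-V, A-V) and `ratioClass_hstep_canonical_le`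
(C-H, B-H); the strip / low-fibre steps are in `…CanonicalStripSteps`.  No definitions; no statement about the crux.
[cite: Grafakos2014, Prop. 3.1.2 (5), Prop. 3.2.7 (3), §3.1.3] [cite: ElgindiLissMattingly2025, §1 (slope ±1 branches)] [problem: turb]
-/

-- `Summit.<Summit>.<Problem>`: single-conjunct summit, the duplicate namespace segment is deliberate.
set_option linter.dupNamespace false

noncomputable section

namespace Summit.AnomalousDissipation.AnomalousDissipation.Theorems.SawtoothPulseCascade.K1Window

open MeasureTheory Set Filter Topology UnitAddTorus Function Complex Metric
open scoped Real ENNReal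
open Literature.Analysis Literature.Analysis.FunctionSpaces Literature.Analysis.FunctionSpaces.Torus Literature.Analysis.FluidPDE
open Literature.Analysis.FluidPDE.ShearStage
open Literature.Analysis.FluidPDE.SawtoothCascade Literature.Analysis.FluidPDE.SawtoothCascade.CascadeParams
open Summit.AnomalousDissipation.AnomalousDissipation.Theorems.SawtoothPulseCascade.K1Start
open Summit.AnomalousDissipation.AnomalousDissipation.Theorems.SawtoothPulseCascade.K1Flat
open Summit.AnomalousDissipation.AnomalousDissipation.Theorems.SawtoothPulseCascade.K1Ledger.From

section Cascade

variable (P : CascadeParams)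

/-! ## §1 The ratio class through the V half-step on canonical blocks (O-V, A-V) -/

/-- **(O-V) / (A-V) ON CANONICAL BLOCKS.**  Class `Σ'[X ≤ |k₀| ∧ u|k₀| ≤ v|k₁|]‖𝓕a_{j+1}‖²` (`0 < u`, `0 < v < uG`), feed slope
`(u′, v′)` (`v′ > 0`), margin `q_n/q_d` with `uq_n < q_d(uG − v)`, fibre floor `Λ₀ ≥ 1` with `vΛ₀ ≤ uX`, lower cut-offs `Q₁^m < Q₂^m` with the feed inclusion,
`Y ≤ Q₁^m + 1` and `r_m ≤ r*`, `M_b` blocks, rounding target `η > 0` with `max(1,√(2log(1/η)))·δ_j < π/2`.  Then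
`class ≤ (√J + √(Σ'[Y ≤ |k₀| ∧ u′|k₁| ≤ v′|k₀|]‖𝓕b_j‖²))² + ((1+γ)^{2(j+1)}/(Λ₀2^{M_b}))²` with `J` as in the file header,
`A* = ((v+uG)q_d + uq_n)/((uG−v)q_d − uq_n)`,
`τ₀ = uπq_d/(((uG−v)q_d − uq_n)Λ₀)`. [cite: Grafakos2014, Prop. 3.1.2 (5), Prop. 3.2.7 (3), §3.1.3] -/
theorem ratioClass_vstep_canonicalQ_le {G : ℕ} (hγ : P.γ = G) (hδ₀ : 0 < P.δ₀) (hd : 0 < P.d) (hN₀ : 1 ≤ P.N₀)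
    (hρN : 1 ≤ P.ρN) (a b : ℕ → UnitAddTorus (Fin 2) → ℝ) (has : ∀ j, IsSmooth (a j)) (h0 : a 0 = datum)
    (hb : ∀ j, b j = a j ∘ shearMap 0 1 (amp ⟨P.U j, P.U_periodic j, P.contDiff_U (P.δ_pos hδ₀ hd j)⟩ P.γ))
    (hab : ∀ j, a (j + 1) = b j ∘ shearMap 1 0 (amp ⟨P.U j, P.U_periodic j, P.contDiff_U (P.δ_pos hδ₀ hd j)⟩ P.γ))
    (j : ℕ) {u v X u' v' Y qn qd Λ0 : ℕ} (hu : 0 < u) (hv : 0 < v) (hvu : v < u * G) (hqd : 0 < qd)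
    (hq : u * qn < qd * (u * G - v)) (hΛ0 : 1 ≤ Λ0) (hΛX : v * Λ0 ≤ u * X)
    (Q₁ : ℕ → ℕ) (hQ : ∀ m, Q₁ m < qn * (Λ0 * 2 ^ m) / qd)
    (hfeed : ∀ m, u' * (Λ0 * 2 ^ (m + 1)) ≤ v' * (Q₁ m + 1)) {rs : ℝ}
    (hr : ∀ m, (((Q₁ m : ℕ) : ℝ) + ((qn * (Λ0 * 2 ^ m) / qd : ℕ) : ℝ)) /
      (((qn * (Λ0 * 2 ^ m) / qd : ℕ) : ℝ) - ((Q₁ m : ℕ) : ℝ)) ≤ rs)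
    (hY : ∀ m, Y ≤ Q₁ m + 1) (Mb : ℕ) {η : ℝ} (hη : 0 < η)
    (hMδ : max 1 (Real.sqrt (2 * Real.log (1 / η))) * P.δ j < π / 2) :
    ∑' k : Fin 2 → ℤ, (if (X : ℤ) ≤ |k 0| ∧ (u : ℤ) * |k 0| ≤ (v : ℤ) * |k 1| then (1 : ℝ) else 0) *
        ‖mFourierCoeff (fun x => (a (j + 1) x : ℂ)) k‖ ^ 2 ≤
      (Real.sqrt (3 * rs ^ 2 *
            (4 / 3 * (((((v : ℝ) + u * G) * qd + u * qn) / (((u : ℝ) * G - v) * qd - u * qn)) * π * G * η * Λ0 / P.N j *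
                2 ^ Mb) ^ 2 +
              128 * P.N j * ((((v : ℝ) + u * G) * qd + u * qn) / (((u : ℝ) * G - v) * qd - u * qn)) *
                ((u : ℝ) * π * qd / ((((u : ℝ) * G - v) * qd - u * qn) * Λ0)) +
              8 * Mb * ((((v : ℝ) + u * G) * qd + u * qn) / (((u : ℝ) * G - v) * qd - u * qn)) ^ 2 *
                (max 1 (Real.sqrt (2 * Real.log (1 / η))) * P.δ j) / π)) +
          Real.sqrt (∑' k : Fin 2 → ℤ, (if (Y : ℤ) ≤ |k 0| ∧ (u' : ℤ) * |k 1| ≤ (v' : ℤ) * |k 0| then (1 : ℝ) else 0) *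
            ‖mFourierCoeff (fun x => (b j x : ℂ)) k‖ ^ 2)) ^ 2 +
        ((1 + P.γ) ^ (2 * (j + 1)) / ((Λ0 * 2 ^ Mb : ℕ) : ℝ)) ^ 2 := by
  -- the canonical data
  set M : ℝ := max 1 (Real.sqrt (2 * Real.log (1 / η))) with hMdef
  have hM : 1 ≤ M := (zoneDepth_facts hη).1
  have hMη : Real.exp (-(M ^ 2 / 2)) ≤ η := (zoneDepth_facts hη).2
  have hN : (0 : ℝ) < P.N j := by exact_mod_cast P.N_pos hN₀ hρN j
  have hδ : 0 < P.δ j := P.δ_pos hδ₀ hd j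
  have hMδ0 : 0 < M * P.δ j := mul_pos (by linarith) hδ
  set Λb : ℕ → ℕ := fun m => Λ0 * 2 ^ m with hΛb
  set Q₂ : ℕ → ℕ := fun m => qn * (Λ0 * 2 ^ m) / qd with hQ₂
  set A : ℕ → ℝ := fun m => (((v : ℝ) + u * G) * Λb m + u * Q₂ m) / (((u : ℝ) * G - v) * Λb m - u * Q₂ m) with hA
  set τ : ℕ → ℝ := fun m => (u : ℝ) * π / (((u : ℝ) * G - v) * Λb m - u * Q₂ m) with hτ
  set As : ℝ := (((v : ℝ) + u * G) * qd + u * qn) / (((u : ℝ) * G - v) * qd - u * qn) with hAs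
  set τ₀ : ℝ := (u : ℝ) * π * qd / ((((u : ℝ) * G - v) * qd - u * qn) * Λ0) with hτ₀
  have hΛge : ∀ m, 1 ≤ Λ0 * 2 ^ m := fun m => hΛ0.trans (canon_blocks_ge Λ0 m)
  have hAfacts : ∀ m, 0 < A m ∧ A m ≤ As := fun m => canon_ratio_A_le hqd hvu hq (hΛge m)
  have hτfacts : ∀ m, 0 ≤ τ m ∧ τ m ≤ τ₀ / 2 ^ m := fun m => canon_ratio_tau_le hqd hvu hq hΛ0 m
  have hΛQ : ∀ m, u * Q₂ m < Λb m * (u * G - v) := fun m => canon_ratio_shift hq (hΛge m)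
  have hur : (0 : ℝ) < u := by exact_mod_cast hu
  have hτpos : ∀ m, 0 < τ m := fun m =>
    div_pos (by positivity) (canon_ratio_den_pos hvu hq (hΛge m))
  set d₀ : ℕ → ℝ := fun m => 8 * τ m / A m + M * P.δ j / (Real.pi * P.N j) with hd₀
  have hdfacts : ∀ m, 0 < d₀ m ∧ M * P.δ j < Real.pi * P.N j * d₀ m ∧ 8 * τ m ≤ A m * d₀ m := fun m =>
    envelopeScale_facts (hAfacts m).1 (hτpos m) hN hMδ0
  set ε₀ : ℕ → ℝ := fun m => A m * (2 * π * ((Λb (m + 1) * G : ℕ) : ℝ) * (Real.exp (-(M ^ 2 / 2)) / (2 * P.N j))) with hε₀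
  have hε0 : ∀ m, 0 ≤ ε₀ m := fun m => by
    have := (hAfacts m).1.le
    positivity
  -- the multi-block step
  have hstep := tsum_ratioClass_vstep_blocks_le P hγ hδ₀ hd hN₀ hρN a b has h0 hb hab j hu hv hvu Λb
    (canon_blocks_monotone Λ0) (by simpa [hΛb] using hΛ0) Mb (by simpa [hΛb] using hΛX) Q₁ Q₂
    hQ hΛQ hM hMδ d₀ ε₀ (fun m => (hdfacts m).1)
    (fun m => (hdfacts m).2.1) (fun m => (hdfacts m).2.2) hε0 (fun m => le_rfl) (u' := u') (v' := v') (Y := Y)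
    hfeed hY
  -- the junk in closed form
  have hjunk := blockJunk_sum_le (r := fun m => ((Q₁ m : ℝ) + Q₂ m) / ((Q₂ m : ℝ) - Q₁ m)) (A := A) (τ := τ) (ε₀ := ε₀)
    (rs := rs) (As := As) (τ₀ := τ₀) (e₀ := As * π * G * η * Λ0 / P.N j) (N := (P.N j : ℝ)) (Mδ := M * P.δ j)
    hN hMδ0.le (by
      have := (hτfacts 0).2; have := (hτfacts 0).1
      have h : τ 0 ≤ τ₀ / 2 ^ 0 := (hτfacts 0).2
      simp at h; linarith)
    (fun m => canon_r_nonneg (hQ m)) hr (fun m => (hAfacts m).1) (fun m => (hAfacts m).2)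
    (fun m => (hτfacts m).1) (fun m => (hτfacts m).2) hε0 (fun m => ?_) Mb
  · -- assemble
    have e2N : ((2 * P.N j : ℕ) : ℝ) = 2 * (P.N j : ℝ) := by push_cast; ring
    rw [e2N] at hstep
    exact le_sq_sqrt_add_mono hstep hjunk
  · -- the rounding allowance on block `m`
    simp only [hε₀]
    have hA' := (hAfacts m).2
    have hA0' := (hAfacts m).1.le
    have eΛ : ((Λb (m + 1) * G : ℕ) : ℝ) = (Λ0 : ℝ) * 2 ^ (m + 1) * G := by
      show ((Λ0 * 2 ^ (m + 1) * G : ℕ) : ℝ) = _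
      push_cast; ring
    rw [eΛ]
    have hAs0 : 0 ≤ As := hA0'.trans hA'
    calc A m * (2 * π * ((Λ0 : ℝ) * 2 ^ (m + 1) * G) * (Real.exp (-(M ^ 2 / 2)) / (2 * P.N j)))
        = A m * Real.exp (-(M ^ 2 / 2)) * (π * G * Λ0 / P.N j * 2 ^ (m + 1)) := by
          field_simp
      _ ≤ As * η * (π * G * Λ0 / P.N j * 2 ^ (m + 1)) :=
          mul_le_mul_of_nonneg_right (mul_le_mul hA' hMη (Real.exp_nonneg _) hAs0) (by positivity)
      _ = As * π * G * η * Λ0 / P.N j * 2 ^ (m + 1) := by ring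


/-! ## §2 The ratio class through the H half-step on canonical blocks (C-H, B-H) -/

/-- **(C-H) / (B-H) ON CANONICAL BLOCKS.**  Class `Σ'[Λ₀ ≤ |k₀| ∧ u|k₁| ≤ v|k₀|]‖𝓕b_j‖²` (`0 < u`, `0 < v < uG`; the class
threshold is the fibre floor `Λ₀ ≥ 1`), feed = the class `Σ'[Y ≤ |k₀| ∧ u′|k₀| ≤ v′|k₁|]‖𝓕a_j‖²` of `a_j` (`v′ > 0`, `Y ≤ Λ₀`),
margin `q_n/q_d` with `uq_n < q_d(uG − v)`, lower cut-offs `Q₁^m < Q₂^m` with the feed inclusion and `r_m ≤ r*`, `M_b` blocks, rounding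
target `η > 0` with `max(1,√(2log(1/η)))·δ_j < π/2`.  Then `class ≤ (√J + √feed)² + ((1+γ)^{2j}/(Λ₀2^{M_b}))²` with `J` as in
the file header,
`A* = ((v+uG)q_d + uq_n)/((uG−v)q_d − uq_n)`,
`τ₀ = uπq_d/(((uG−v)q_d − uq_n)Λ₀)`. [cite: Grafakos2014, Prop. 3.1.2 (5), Prop. 3.2.7 (3), §3.1.3] -/
theorem ratioClass_hstep_canonicalQ_le {G : ℕ} (hγ : P.γ = G) (hδ₀ : 0 < P.δ₀) (hd : 0 < P.d) (hN₀ : 1 ≤ P.N₀)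
    (hρN : 1 ≤ P.ρN) (a b : ℕ → UnitAddTorus (Fin 2) → ℝ) (has : ∀ j, IsSmooth (a j)) (h0 : a 0 = datum)
    (hb : ∀ j, b j = a j ∘ shearMap 0 1 (amp ⟨P.U j, P.U_periodic j, P.contDiff_U (P.δ_pos hδ₀ hd j)⟩ P.γ))
    (hab : ∀ j, a (j + 1) = b j ∘ shearMap 1 0 (amp ⟨P.U j, P.U_periodic j, P.contDiff_U (P.δ_pos hδ₀ hd j)⟩ P.γ))
    (j : ℕ) {u v u' v' Y qn qd Λ0 : ℕ} (hu : 0 < u) (hv : 0 < v) (hvu : v < u * G) (hqd : 0 < qd)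
    (hq : u * qn < qd * (u * G - v)) (hΛ0 : 1 ≤ Λ0) (hY : Y ≤ Λ0)
    (Q₁ : ℕ → ℕ) (hQ : ∀ m, Q₁ m < qn * (Λ0 * 2 ^ m) / qd)
    (hfeed : ∀ m, u' * (Λ0 * 2 ^ (m + 1)) ≤ v' * (Q₁ m + 1)) {rs : ℝ}
    (hr : ∀ m, (((Q₁ m : ℕ) : ℝ) + ((qn * (Λ0 * 2 ^ m) / qd : ℕ) : ℝ)) /
      (((qn * (Λ0 * 2 ^ m) / qd : ℕ) : ℝ) - ((Q₁ m : ℕ) : ℝ)) ≤ rs)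
    (Mb : ℕ) {η : ℝ} (hη : 0 < η)
    (hMδ : max 1 (Real.sqrt (2 * Real.log (1 / η))) * P.δ j < π / 2) :
    ∑' k : Fin 2 → ℤ, (if (Λ0 : ℤ) ≤ |k 0| ∧ (u : ℤ) * |k 1| ≤ (v : ℤ) * |k 0| then (1 : ℝ) else 0) *
        ‖mFourierCoeff (fun x => (b j x : ℂ)) k‖ ^ 2 ≤
      (Real.sqrt (3 * rs ^ 2 *
            (4 / 3 * (((((v : ℝ) + u * G) * qd + u * qn) / (((u : ℝ) * G - v) * qd - u * qn)) * π * G * η * Λ0 / P.N j *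
                2 ^ Mb) ^ 2 +
              128 * P.N j * ((((v : ℝ) + u * G) * qd + u * qn) / (((u : ℝ) * G - v) * qd - u * qn)) *
                ((u : ℝ) * π * qd / ((((u : ℝ) * G - v) * qd - u * qn) * Λ0)) +
              8 * Mb * ((((v : ℝ) + u * G) * qd + u * qn) / (((u : ℝ) * G - v) * qd - u * qn)) ^ 2 *
                (max 1 (Real.sqrt (2 * Real.log (1 / η))) * P.δ j) / π)) +
          Real.sqrt (∑' k : Fin 2 → ℤ, (if (Y : ℤ) ≤ |k 0| ∧ (u' : ℤ) * |k 0| ≤ (v' : ℤ) * |k 1| then (1 : ℝ) else 0) *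
            ‖mFourierCoeff (fun x => (a j x : ℂ)) k‖ ^ 2)) ^ 2 +
        ((1 + P.γ) ^ (2 * j) / ((Λ0 * 2 ^ Mb : ℕ) : ℝ)) ^ 2 := by
  -- the canonical data
  set M : ℝ := max 1 (Real.sqrt (2 * Real.log (1 / η))) with hMdef
  have hM : 1 ≤ M := (zoneDepth_facts hη).1
  have hMη : Real.exp (-(M ^ 2 / 2)) ≤ η := (zoneDepth_facts hη).2
  have hN : (0 : ℝ) < P.N j := by exact_mod_cast P.N_pos hN₀ hρN j
  have hδ : 0 < P.δ j := P.δ_pos hδ₀ hd j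
  have hMδ0 : 0 < M * P.δ j := mul_pos (by linarith) hδ
  set Λb : ℕ → ℕ := fun m => Λ0 * 2 ^ m with hΛb
  set Q₂ : ℕ → ℕ := fun m => qn * (Λ0 * 2 ^ m) / qd with hQ₂
  set A : ℕ → ℝ := fun m => (((v : ℝ) + u * G) * Λb m + u * Q₂ m) / (((u : ℝ) * G - v) * Λb m - u * Q₂ m) with hA
  set τ : ℕ → ℝ := fun m => (u : ℝ) * π / (((u : ℝ) * G - v) * Λb m - u * Q₂ m) with hτ
  set As : ℝ := (((v : ℝ) + u * G) * qd + u * qn) / (((u : ℝ) * G - v) * qd - u * qn) with hAs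
  set τ₀ : ℝ := (u : ℝ) * π * qd / ((((u : ℝ) * G - v) * qd - u * qn) * Λ0) with hτ₀
  have hΛge : ∀ m, 1 ≤ Λ0 * 2 ^ m := fun m => hΛ0.trans (canon_blocks_ge Λ0 m)
  have hAfacts : ∀ m, 0 < A m ∧ A m ≤ As := fun m => canon_ratio_A_le hqd hvu hq (hΛge m)
  have hτfacts : ∀ m, 0 ≤ τ m ∧ τ m ≤ τ₀ / 2 ^ m := fun m => canon_ratio_tau_le hqd hvu hq hΛ0 m
  have hΛQ : ∀ m, u * Q₂ m < Λb m * (u * G - v) := fun m => canon_ratio_shift hq (hΛge m)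
  have hur : (0 : ℝ) < u := by exact_mod_cast hu
  have hτpos : ∀ m, 0 < τ m := fun m =>
    div_pos (by positivity) (canon_ratio_den_pos hvu hq (hΛge m))
  set d₀ : ℕ → ℝ := fun m => 8 * τ m / A m + M * P.δ j / (Real.pi * P.N j) with hd₀
  have hdfacts : ∀ m, 0 < d₀ m ∧ M * P.δ j < Real.pi * P.N j * d₀ m ∧ 8 * τ m ≤ A m * d₀ m := fun m =>
    envelopeScale_facts (hAfacts m).1 (hτpos m) hN hMδ0
  set ε₀ : ℕ → ℝ := fun m => A m * (2 * π * ((Λb (m + 1) * G : ℕ) : ℝ) * (Real.exp (-(M ^ 2 / 2)) / (2 * P.N j))) with hε₀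
  have hε0 : ∀ m, 0 ≤ ε₀ m := fun m => by
    have := (hAfacts m).1.le
    positivity
  -- the multi-block step
  have hstep := tsum_ratioClass_hstep_blocks_le P hγ hδ₀ hd hN₀ hρN a b has h0 hb hab j hu hv hvu Λb
    (canon_blocks_monotone Λ0) (by simpa [hΛb] using hΛ0) Mb Q₁ Q₂
    hQ hΛQ hM hMδ d₀ ε₀ (fun m => (hdfacts m).1)
    (fun m => (hdfacts m).2.1) (fun m => (hdfacts m).2.2) hε0 (fun m => le_rfl) (u' := u') (v' := v') (Y := Y)
    hfeed (by simpa [hΛb] using hY)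
  -- the junk in closed form
  have hjunk := blockJunk_sum_le (r := fun m => ((Q₁ m : ℝ) + Q₂ m) / ((Q₂ m : ℝ) - Q₁ m)) (A := A) (τ := τ) (ε₀ := ε₀)
    (rs := rs) (As := As) (τ₀ := τ₀) (e₀ := As * π * G * η * Λ0 / P.N j) (N := (P.N j : ℝ)) (Mδ := M * P.δ j)
    hN hMδ0.le (by
      have := (hτfacts 0).2; have := (hτfacts 0).1
      have h : τ 0 ≤ τ₀ / 2 ^ 0 := (hτfacts 0).2
      simp at h; linarith)
    (fun m => canon_r_nonneg (hQ m)) hr (fun m => (hAfacts m).1) (fun m => (hAfacts m).2)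
    (fun m => (hτfacts m).1) (fun m => (hτfacts m).2) hε0 (fun m => ?_) Mb
  · -- assemble
    have e2N : ((2 * P.N j : ℕ) : ℝ) = 2 * (P.N j : ℝ) := by push_cast; ring
    rw [e2N] at hstep
    have e0 : Λb 0 = Λ0 := by simp [hΛb]
    rw [e0] at hstep
    exact le_sq_sqrt_add_mono hstep hjunk
  · -- the rounding allowance on block `m`
    simp only [hε₀]
    have hA' := (hAfacts m).2
    have hA0' := (hAfacts m).1.le
    have eΛ : ((Λb (m + 1) * G : ℕ) : ℝ) = (Λ0 : ℝ) * 2 ^ (m + 1) * G := by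
      show ((Λ0 * 2 ^ (m + 1) * G : ℕ) : ℝ) = _
      push_cast; ring
    rw [eΛ]
    have hAs0 : 0 ≤ As := hA0'.trans hA'
    calc A m * (2 * π * ((Λ0 : ℝ) * 2 ^ (m + 1) * G) * (Real.exp (-(M ^ 2 / 2)) / (2 * P.N j)))
        = A m * Real.exp (-(M ^ 2 / 2)) * (π * G * Λ0 / P.N j * 2 ^ (m + 1)) := by
          field_simp
      _ ≤ As * η * (π * G * Λ0 / P.N j * 2 ^ (m + 1)) :=
          mul_le_mul_of_nonneg_right (mul_le_mul hA' hMη (Real.exp_nonneg _) hAs0) (by positivity)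
      _ = As * π * G * η * Λ0 / P.N j * 2 ^ (m + 1) := by ring

end Cascade

end Summit.AnomalousDissipation.AnomalousDissipation.Theorems.SawtoothPulseCascade.K1Window
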